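import Literature.NumberTheory.K2Lit.SiegelEisensteinSeriesDoubled
import Literature.NumberTheory.K2Lit.DoublingEmbedding
import Mathlib.MeasureTheory.Integral.Bochner.Basic
import HarnessLib

/-!
# The unipotent radical `N_Δ` of the Siegel parabolic of the doubled unitary group, the Weyl element `w_Δ`,
# the constant term along `N_Δ` and the Siegel intertwining integral (K2Lit leaf D9)

Track B «K2-LIT», crux hLiu418 = `stmt-HodgeConjecture-24832`, road `K2_Liu`, socket #41 `sig_K2LiuSiegelEisensteinContinuation`
(U6 «FIRST TERM»), organ O41.2 of the steward's REPORT-FIRST (K2Liu-p01 (g0), LEAD F0P6-plan (g10) ruling A2 2026-09-03T22:32:11Z).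
DEFINITIONS WITH BODIES + their algebra; no `instance`, no `notation`, no `sorry`.  Namespace shared with ★ `SiegelEisensteinSeriesDoubled`
(`siegelDelta`, `siegelDeltaCharacter`, `IsSiegelDeltaSection`) and with K2Liu-p09's Levi leaf `SiegelDoubledLeviSemidirect` (`leviPart`,
`siegelLeviIn`, `siegelUnipotentIn : Subgroup ↥siegelDelta` — the SAME predicate as `unipDelta` below, read inside `P_Δ(𝔸)`; the one-line
comparison `unipDelta = siegelUnipotentIn.map siegelDelta.subtype` is owed by whichever leaf lands second).

CONTENTS.
* §1 `unipDelta : Subgroup (HA …)` — `N_Δ(𝔸) = {u ∈ P_Δ(𝔸) : u|_Δ = 1, u|_{𝔻/Δ} = 1}`; in the triangular frame `E₁ · blk u · E₂` of ★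
  `DoubledUnitarySiegelParabolicAlgebra` (`E₁ = (1 0; −1 1)`, `E₂ = E₁⁻¹`) these are exactly the matrices `(1 X; 0 1)` (`mem_unipDelta_iff_conj`);
  `N_Δ(𝔸)` is commutative (`mul_comm_of_mem_unipDelta`), `det_Δ = 1`, `χ(det_Δ) = 1`, `|det_Δ| = 1` on it, so the inducing character
  `siegelDeltaCharacter χ s` is trivial on `N_Δ(𝔸)` and every Siegel section is left-`N_Δ(𝔸)`-invariant (`apply_unipDelta_mul`).
* §2 `unipDeltaRat` — `N_Δ(L⁺) = N_Δ(𝔸) ∩ H(L⁺)` inside `N_Δ(𝔸)`; `UnipDeltaQuot = N_Δ(L⁺)\N_Δ(𝔸)` (a quotient of a commutative group).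
* §3 `weylDelta := ι(1, −1) ∈ H(𝔸)` — the representative of the big Bruhat cell `P_Δ w_Δ P_Δ` (it swaps `Δ = {(x,x)}` and `Δ⁻ = {(x,−x)}`);
  `blk weylDelta = diag(1, −1)`, `weylDelta² = 1`.
* §4 `constTermDelta ν φ h := ∫_{N_Δ(L⁺)\N_Δ(𝔸)} φ(u h) dν(u)` and `intertwiningDelta νN f h := ∫_{N_Δ(𝔸)} f(w_Δ u h) dνN(u)` — the constant term
  along `N_Δ` and the Siegel intertwining integral `M(s)`, with the MEASURES AS PARAMETERS (the sockets quantify «`ν` the invariant probability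
  measure», «`νN` a Haar measure»; no measure is constructed here, R8), plus `constTermDelta_of_isSiegelDeltaSection`
  (`= ν(N_Δ(L⁺)\N_Δ(𝔸)) · f(h)` for a Siegel section).
HONEST LABEL.  Carriers only; `HC_CM` is proved only modulo the 7 printed citations (2 remaining named inputs: hLiu418 = 24832, h413 = 24833)
until rung 0 closes.

## References
* [MoeglinWaldspurger1995] C. Mœglin, J.-L. Waldspurger, *Spectral decomposition and Eisenstein series*, CUP (1995): I.2.1 (parabolic subgroups,
  `P = MN`), II.1.6–II.1.7 (intertwining operators, constant terms of Eisenstein series).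
* [Tan1999] V. Tan, *Poles of Siegel Eisenstein series on U(n,n)*, Canad. J. Math. 51 (1999), §§1–2.
* [GelbartPiatetskishapiroRallis1987] S. Gelbart, I. Piatetski-Shapiro, S. Rallis, LNM 1254 (1987), Part A §§1–2 (the doubled group, `P`, `w`).
* [Kudla1994] S. Kudla, *Splitting metaplectic covers of dual reductive pairs*, Israel J. Math. 87 (1994), §2 (doubled space, Siegel parabolic).
-/

noncomputable section

open scoped Matrix
open NumberField IsDedekindDomain MeasureTheory

namespace Literature.NumberTheory.K2Lit.SiegelDoubled

open Literature.NumberTheory.Automorphic Literature.NumberTheory.GaloisRepresentations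
open Literature.NumberTheory.GelbartRogawski1991 Literature.NumberTheory.GelbartRogawski1991.GRConstruction

variable (L : Type) [Field L] [NumberField L] [IsCMField L]
variable {N M n : ℕ} (e : Fin N × Fin M ≃ Fin n)
  (dV : Fin N → L) (hdV : ∀ i, IsCMField.complexConj L (dV i) = dV i)
  (dW : Fin M → L) (hdW : ∀ i, IsCMField.complexConj L (dW i) = dW i)

/-! ## §0 Block bookkeeping in the triangular frame `E₁ · blk(·) · E₂` -/

/-- `blk` is injective: an element of `H(𝔸) ≤ GL_{n+n}(𝔸_L)` is determined by its block matrix. [cite: Kudla1994, §2] -/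
theorem eq_of_blk_eq {x y : HA L e dV hdV dW hdW} (h : blk L e dV hdV dW hdW x = blk L e dV hdV dW hdW y) : x = y :=
  Subtype.ext (Units.ext ((Matrix.reindex _ _).injective h))

/-- the triangular frame is injective: `E₁ X E₂ = E₁ Y E₂ → X = Y` (`E₂ E₁ = 1 = E₁ E₂`). [cite: Kudla1994, §2] -/
theorem eq_of_conjE_eq {R : Type*} [CommRing R] {m : Type*} [Fintype m] [DecidableEq m] {X Y : Matrix (m ⊕ m) (m ⊕ m) R}
    (h : Matrix.fromBlocks (1 : Matrix m m R) 0 (-1) 1 * X * Matrix.fromBlocks 1 0 1 1 =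
      Matrix.fromBlocks (1 : Matrix m m R) 0 (-1) 1 * Y * Matrix.fromBlocks 1 0 1 1) : X = Y := by
  have key : ∀ Z : Matrix (m ⊕ m) (m ⊕ m) R,
      Matrix.fromBlocks (1 : Matrix m m R) 0 1 1 * (Matrix.fromBlocks (1 : Matrix m m R) 0 (-1) 1 * Z * Matrix.fromBlocks 1 0 1 1) *
        Matrix.fromBlocks (1 : Matrix m m R) 0 (-1) 1 = Z := by
    intro Z
    rw [show Matrix.fromBlocks (1 : Matrix m m R) 0 1 1 * (Matrix.fromBlocks (1 : Matrix m m R) 0 (-1) 1 * Z * Matrix.fromBlocks 1 0 1 1) *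
        Matrix.fromBlocks (1 : Matrix m m R) 0 (-1) 1 =
        (Matrix.fromBlocks (1 : Matrix m m R) 0 1 1 * Matrix.fromBlocks (1 : Matrix m m R) 0 (-1) 1) * Z *
          (Matrix.fromBlocks (1 : Matrix m m R) 0 1 1 * Matrix.fromBlocks (1 : Matrix m m R) 0 (-1) 1) by
      simp only [Matrix.mul_assoc], E₂_mul_E₁, Matrix.one_mul, Matrix.mul_one]
  rw [← key X, ← key Y, h]

/-- unipotent triangular blocks multiply by adding the corners: `(1 X; 0 1)(1 Y; 0 1) = (1 (Y + X); 0 1)`. [cite: Kudla1994, §2] -/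
theorem fromBlocks_unip_mul {R : Type*} [CommRing R] {m : Type*} [Fintype m] [DecidableEq m] (X Y : Matrix m m R) :
    Matrix.fromBlocks (1 : Matrix m m R) X (0 : Matrix m m R) (1 : Matrix m m R) * Matrix.fromBlocks (1 : Matrix m m R) Y (0 : Matrix m m R) 1 =
      Matrix.fromBlocks (1 : Matrix m m R) (Y + X) (0 : Matrix m m R) 1 := by
  rw [Matrix.fromBlocks_multiply]
  simp only [Matrix.one_mul, Matrix.mul_one, Matrix.zero_mul, Matrix.mul_zero, add_zero, zero_add]

/-- … hence `(1 X; 0 1)⁻¹ = (1 (−X); 0 1)`. [cite: Kudla1994, §2] -/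
theorem fromBlocks_unip_inv {R : Type*} [CommRing R] {m : Type*} [Fintype m] [DecidableEq m] (X : Matrix m m R) :
    (Matrix.fromBlocks (1 : Matrix m m R) X (0 : Matrix m m R) (1 : Matrix m m R))⁻¹ = Matrix.fromBlocks (1 : Matrix m m R) (-X) (0 : Matrix m m R) 1 :=
  Matrix.inv_eq_left_inv (by rw [fromBlocks_unip_mul, add_neg_cancel, Matrix.fromBlocks_one])

/-! ## §1 `N_Δ(𝔸)` -/

/-- **The unipotent radical `N_Δ(𝔸) ≤ H(𝔸)` of the Siegel parabolic** `P_Δ = M_Δ N_Δ`: the elements of `P_Δ(𝔸)` acting trivially on `Δ`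
(`u|_Δ = ★ deltaBlock u = 1`) and on `𝔻/Δ` (`u₂₂ − u₁₂ = 1`), i.e. whose triangular frame `E₁ · blk u · E₂` is `(1 X; 0 1)`
(`mem_unipDelta_iff_conj`).  Same predicate as K2Liu-p09's `siegelUnipotentIn ≤ ↥siegelDelta`, read in `H(𝔸)`.
[cite: MoeglinWaldspurger1995, I.2.1] [cite: Tan1999, §1] [cite: GelbartPiatetskishapiroRallis1987, Part A §1] -/
def unipDelta : Subgroup (HA L e dV hdV dW hdW) where
  carrier := {u | ∃ X : Matrix (Fin n) (Fin n) (AdeleRing (𝓞 L) L),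
    Matrix.fromBlocks (1 : Matrix (Fin n) (Fin n) (AdeleRing (𝓞 L) L)) 0 (-1) 1 * blk L e dV hdV dW hdW u * Matrix.fromBlocks 1 0 1 1 =
      Matrix.fromBlocks 1 X 0 1}
  one_mem' := ⟨0, by rw [conj_blk_one, Matrix.fromBlocks_one]⟩
  mul_mem' := by
    rintro p q ⟨X, hX⟩ ⟨Y, hY⟩
    exact ⟨Y + X, by rw [conj_blk_mul, hX, hY, fromBlocks_unip_mul]⟩
  inv_mem' := by
    rintro p ⟨X, hX⟩
    refine ⟨-X, ?_⟩
    have h1 := conj_blk_mul L e dV hdV dW hdW p⁻¹ p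
    rw [inv_mul_cancel, conj_blk_one, hX] at h1
    rw [← fromBlocks_unip_inv, Matrix.inv_eq_left_inv h1.symm]

/-- Membership in `N_Δ(𝔸)` through the triangular frame: `E₁ · blk u · E₂ = (1 X; 0 1)` for some `X`. [cite: Kudla1994, §2] -/
theorem mem_unipDelta_iff (u : HA L e dV hdV dW hdW) :
    u ∈ unipDelta L e dV hdV dW hdW ↔ ∃ X : Matrix (Fin n) (Fin n) (AdeleRing (𝓞 L) L),
      Matrix.fromBlocks (1 : Matrix (Fin n) (Fin n) (AdeleRing (𝓞 L) L)) 0 (-1) 1 * blk L e dV hdV dW hdW u * Matrix.fromBlocks 1 0 1 1 =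
        Matrix.fromBlocks 1 X 0 1 :=
  Iff.rfl

/-- … the corner is then the block `u₁₂`: `E₁ · blk u · E₂ = (1 u₁₂; 0 1)`. [cite: Kudla1994, §2] -/
theorem mem_unipDelta_iff_conj (u : HA L e dV hdV dW hdW) :
    u ∈ unipDelta L e dV hdV dW hdW ↔
      Matrix.fromBlocks (1 : Matrix (Fin n) (Fin n) (AdeleRing (𝓞 L) L)) 0 (-1) 1 * blk L e dV hdV dW hdW u * Matrix.fromBlocks 1 0 1 1 =
        Matrix.fromBlocks 1 (blk L e dV hdV dW hdW u).toBlocks₁₂ 0 1 := by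
  refine ⟨?_, fun h => ⟨_, h⟩⟩
  rintro ⟨X, hX⟩
  have h12 : (blk L e dV hdV dW hdW u).toBlocks₁₂ = X := by
    have := congrArg Matrix.toBlocks₁₂ hX
    rwa [conjE_eq, Matrix.toBlocks_fromBlocks₁₂, Matrix.toBlocks_fromBlocks₁₂] at this
  rw [h12, hX]

/-- **`N_Δ(𝔸)` in the language of ★ `IsSiegelDelta` ∕ ★ `deltaBlock`** (K2Liu-p09's predicate): `u ∈ N_Δ(𝔸)` iff `u ∈ P_Δ(𝔸)`, `u|_Δ = 1` and
`u₂₂ − u₁₂ = 1`. [cite: MoeglinWaldspurger1995, I.2.1] [cite: Kudla1994, §2] -/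
theorem mem_unipDelta_iff_blocks (u : HA L e dV hdV dW hdW) :
    u ∈ unipDelta L e dV hdV dW hdW ↔ IsSiegelDelta L e dV hdV dW hdW u ∧ deltaBlock L e dV hdV dW hdW u = 1 ∧
      (blk L e dV hdV dW hdW u).toBlocks₂₂ - (blk L e dV hdV dW hdW u).toBlocks₁₂ = 1 := by
  rw [mem_unipDelta_iff_conj, isSiegelDelta_iff_conj, deltaBlock_eq_conj, conjE_eq, Matrix.toBlocks_fromBlocks₂₁, Matrix.toBlocks_fromBlocks₁₁,
    Matrix.fromBlocks_inj]
  tauto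

/-- `N_Δ(𝔸) ≤ P_Δ(𝔸)`. [cite: MoeglinWaldspurger1995, I.2.1] -/
theorem unipDelta_le_siegelDelta : unipDelta L e dV hdV dW hdW ≤ siegelDelta L e dV hdV dW hdW := fun u hu =>
  ((mem_unipDelta_iff_blocks L e dV hdV dW hdW u).1 hu).1

/-- elements of `N_Δ(𝔸)` are Siegel. [cite: MoeglinWaldspurger1995, I.2.1] -/
theorem isSiegelDelta_of_mem_unipDelta {u : HA L e dV hdV dW hdW} (hu : u ∈ unipDelta L e dV hdV dW hdW) :
    IsSiegelDelta L e dV hdV dW hdW u :=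
  ((mem_unipDelta_iff_blocks L e dV hdV dW hdW u).1 hu).1

/-- `u|_Δ = 1` on `N_Δ(𝔸)`. [cite: MoeglinWaldspurger1995, I.2.1] -/
theorem deltaBlock_eq_one_of_mem_unipDelta {u : HA L e dV hdV dW hdW} (hu : u ∈ unipDelta L e dV hdV dW hdW) :
    deltaBlock L e dV hdV dW hdW u = 1 :=
  ((mem_unipDelta_iff_blocks L e dV hdV dW hdW u).1 hu).2.1

/-- **`N_Δ(𝔸)` is commutative** (`(1 X; 0 1)(1 Y; 0 1) = (1 (X+Y); 0 1)`; `N_Δ ≅ Herm_n` as an additive group).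
[cite: MoeglinWaldspurger1995, I.2.1] [cite: Tan1999, §1] -/
theorem mul_comm_of_mem_unipDelta {p q : HA L e dV hdV dW hdW} (hp : p ∈ unipDelta L e dV hdV dW hdW) (hq : q ∈ unipDelta L e dV hdV dW hdW) :
    p * q = q * p := by
  obtain ⟨X, hX⟩ := hp
  obtain ⟨Y, hY⟩ := hq
  refine eq_of_blk_eq L e dV hdV dW hdW (eq_of_conjE_eq ?_)
  rw [conj_blk_mul, conj_blk_mul, hX, hY, fromBlocks_unip_mul, fromBlocks_unip_mul, add_comm]

/-- `det_Δ u = 1` on `N_Δ(𝔸)`. [cite: Tan1999, §1] -/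
theorem detDelta_eq_one_of_mem_unipDelta {u : HA L e dV hdV dW hdW} (hu : u ∈ unipDelta L e dV hdV dW hdW) :
    detDelta L e dV hdV dW hdW u = 1 := by
  unfold detDelta
  rw [deltaBlock_eq_one_of_mem_unipDelta L e dV hdV dW hdW hu, Matrix.det_one]

/-- `χ(det_Δ u) = 1` on `N_Δ(𝔸)`. [cite: Tan1999, §1] -/
theorem chiDet_eq_one_of_mem_unipDelta (χ : HeckeCharacter L) {u : HA L e dV hdV dW hdW} (hu : u ∈ unipDelta L e dV hdV dW hdW) :
    chiDet L e dV hdV dW hdW χ u = 1 := by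
  have hd := detDelta_eq_one_of_mem_unipDelta L e dV hdV dW hdW hu
  have hunit : IsUnit (detDelta L e dV hdV dW hdW u) := by rw [hd]; exact isUnit_one
  have h1 : hunit.unit = 1 := Units.ext (by rw [IsUnit.unit_spec, hd, Units.val_one])
  unfold chiDet
  rw [dif_pos hunit, h1, map_one]

/-- `|det_Δ u|^{1/2} = 1` on `N_Δ(𝔸)`. [cite: Tan1999, §1] -/
theorem modDelta_eq_one_of_mem_unipDelta {u : HA L e dV hdV dW hdW} (hu : u ∈ unipDelta L e dV hdV dW hdW) :
    modDelta L e dV hdV dW hdW u = 1 := by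
  have hd := detDelta_eq_one_of_mem_unipDelta L e dV hdV dW hdW hu
  have hunit : IsUnit (detDelta L e dV hdV dW hdW u) := by rw [hd]; exact isUnit_one
  have h1 : hunit.unit = 1 := Units.ext (by rw [IsUnit.unit_spec, hd, Units.val_one])
  unfold modDelta
  rw [dif_pos hunit, h1, ← coe_ideleNorm, map_one, NNReal.coe_one, Real.sqrt_one]

/-- **The inducing character `χ(det_Δ ·)|det_Δ ·|^{s+n/2}` is trivial on `N_Δ(𝔸)`.** [cite: Tan1999, §1] [cite: MoeglinWaldspurger1995, II.1.6] -/
theorem siegelDeltaCharacter_eq_one_of_mem_unipDelta (χ : HeckeCharacter L) (s : ℂ) {u : HA L e dV hdV dW hdW}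
    (hu : u ∈ unipDelta L e dV hdV dW hdW) : siegelDeltaCharacter L e dV hdV dW hdW χ s u = 1 := by
  unfold siegelDeltaCharacter
  rw [chiDet_eq_one_of_mem_unipDelta L e dV hdV dW hdW χ hu, modDelta_eq_one_of_mem_unipDelta L e dV hdV dW hdW hu]
  simp

variable {L e dV hdV dW hdW} in
/-- **Siegel sections are left-`N_Δ(𝔸)`-invariant**: `f(u h) = f(h)` for `u ∈ N_Δ(𝔸)`, `f ∈ I(s, χ)`.
[cite: Tan1999, §1] [cite: MoeglinWaldspurger1995, II.1.7] -/
theorem apply_unipDelta_mul {χ : HeckeCharacter L} {s : ℂ} {f : HA L e dV hdV dW hdW → ℂ}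
    (hf : IsSiegelDeltaSection L e dV hdV dW hdW χ s f) {u : HA L e dV hdV dW hdW} (hu : u ∈ unipDelta L e dV hdV dW hdW)
    (h : HA L e dV hdV dW hdW) : f (u * h) = f h := by
  rw [hf u (isSiegelDelta_of_mem_unipDelta L e dV hdV dW hdW hu) h, siegelDeltaCharacter_eq_one_of_mem_unipDelta L e dV hdV dW hdW χ s hu,
    one_mul]

/-! ## §2 `N_Δ(L⁺)` and the compact quotient `N_Δ(L⁺)\N_Δ(𝔸)` -/

/-- **`N_Δ(L⁺) = N_Δ(𝔸) ∩ H(L⁺)`**, as a subgroup of `N_Δ(𝔸)` (★ `ratH` = the rational points of `H`). [cite: MoeglinWaldspurger1995, I.2.1] -/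
def unipDeltaRat : Subgroup (unipDelta L e dV hdV dW hdW) :=
  (ratH L e dV hdV dW hdW).subgroupOf (unipDelta L e dV hdV dW hdW)

/-- membership in `N_Δ(L⁺)`. [cite: MoeglinWaldspurger1995, I.2.1] -/
theorem mem_unipDeltaRat_iff (u : unipDelta L e dV hdV dW hdW) :
    u ∈ unipDeltaRat L e dV hdV dW hdW ↔ (u : HA L e dV hdV dW hdW) ∈ ratH L e dV hdV dW hdW :=
  Subgroup.mem_subgroupOf

/-- **`N_Δ(L⁺)\N_Δ(𝔸)`** — the (compact, commutative) domain of integration of the constant term along `N_Δ`; since `N_Δ(𝔸)` is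
commutative (`mul_comm_of_mem_unipDelta`) left and right cosets agree. [cite: MoeglinWaldspurger1995, I.2.1, II.1.7] -/
abbrev UnipDeltaQuot : Type :=
  unipDelta L e dV hdV dW hdW ⧸ unipDeltaRat L e dV hdV dW hdW

/-! ## §3 The Weyl element `w_Δ = ι(1, −1)` -/

/-- **the scalar `−1 ∈ G₁(𝔸) = U(J_V ⊗ J_W)(𝔸)`** (a `c`-norm-one scalar, ★ `scalar_mem_unitaryGroupOfForm`). [cite: GelbartRogawski1991, §3.1 p. 454] -/
def negOnePair : UnitaryGroup.adelicPair (Fp L) L (IsCMField.complexConj L) N M (Matrix.diagonal dV) (Matrix.diagonal dW) :=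
  ⟨Units.map (Matrix.scalar (Fin N × Fin M) : AdeleRing (𝓞 L) L →+* Matrix (Fin N × Fin M) (Fin N × Fin M) (AdeleRing (𝓞 L) L)).toMonoidHom (-1),
    scalar_mem_unitaryGroupOfForm _ _ (-1) (by rw [Units.val_neg, Units.val_one, map_neg, map_one, neg_mul_neg, one_mul])⟩

/-- the matrix of `−1 ∈ G₁(𝔸)` is `−1`. [cite: GelbartRogawski1991, §3.1 p. 454] -/
theorem coe_negOnePair :
    (((negOnePair L dV dW : UnitaryGroup.adelicPair (Fp L) L (IsCMField.complexConj L) N M (Matrix.diagonal dV) (Matrix.diagonal dW)) :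
        GL (Fin N × Fin M) (AdeleRing (𝓞 L) L)) : Matrix (Fin N × Fin M) (Fin N × Fin M) (AdeleRing (𝓞 L) L)) = -1 := by
  change (((Matrix.scalar (Fin N × Fin M) : AdeleRing (𝓞 L) L →+* _).toMonoidHom) ((-1 : (AdeleRing (𝓞 L) L)ˣ) : AdeleRing (𝓞 L) L)) = -1
  rw [RingHom.toMonoidHom_eq_coe, MonoidHom.coe_coe, Units.val_neg, Units.val_one, map_neg, map_one]

/-- `(−1)² = 1` in `G₁(𝔸)`. [cite: GelbartRogawski1991, §3.1 p. 454] -/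
theorem negOnePair_mul_negOnePair : negOnePair L dV dW * negOnePair L dV dW =
    (1 : UnitaryGroup.adelicPair (Fp L) L (IsCMField.complexConj L) N M (Matrix.diagonal dV) (Matrix.diagonal dW)) := by
  refine Subtype.ext (Units.ext ?_)
  rw [Subgroup.coe_mul, Units.val_mul, coe_negOnePair, OneMemClass.coe_one, Units.val_one, neg_mul_neg, one_mul]

/-- **`w_Δ := ι(1, −1) ∈ H(𝔸)`** (★ `iotaGG`): it exchanges the Lagrangians `Δ = {(x, x)}` and `Δ⁻ = {(x, −x)}` of `𝔻 = 𝕍 ⊕ 𝕍⁻`, hence represents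
the big cell `P_Δ w_Δ P_Δ` of `P_Δ\H/P_Δ` and enters the Siegel intertwining integral `M(s)f(h) = ∫_{N_Δ(𝔸)} f(w_Δ u h) du`; it is the image of
the rational pair `(1, −1)`, so it lies in `H(L⁺)` (bookkeeping owed with the Bruhat cells, organ O41.1).
[cite: GelbartPiatetskishapiroRallis1987, Part A §1] [cite: Tan1999, §2] -/
def weylDelta : HA L e dV hdV dW hdW :=
  iotaGG L e dV hdV dW hdW (1, negOnePair L dV dW)

/-- the block matrix of `ι(x₁, x₂)` is `diag(x₁ₑ, x₂ₑ)` (restates, for use inside `Literature/`, the `Summits`-side helper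
`K2LiuDoublingUnfoldOrbitPrelims.blk_iotaGG`, which a Literature leaf cannot import). [cite: GelbartPiatetskishapiroRallis1987, Part A §1] -/
theorem blk_iotaGG_eq (x : UnitaryGroup.adelicPair (Fp L) L (IsCMField.complexConj L) N M (Matrix.diagonal dV) (Matrix.diagonal dW) ×
      UnitaryGroup.adelicPair (Fp L) L (IsCMField.complexConj L) N M (Matrix.diagonal dV) (Matrix.diagonal dW)) :
    blk L e dV hdV dW hdW (iotaGG L e dV hdV dW hdW x) =
      Matrix.fromBlocks
        (Matrix.reindex e e ((x.1 : GL (Fin N × Fin M) (AdeleRing (𝓞 L) L)) : Matrix (Fin N × Fin M) (Fin N × Fin M) (AdeleRing (𝓞 L) L)))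
        0 0
        (Matrix.reindex e e ((x.2 : GL (Fin N × Fin M) (AdeleRing (𝓞 L) L)) : Matrix (Fin N × Fin M) (Fin N × Fin M) (AdeleRing (𝓞 L) L))) := by
  rw [blk, coe_iotaGG, UnitaryGroup.coe_reindexGL, UnitaryGroup.coe_blockDiagGL, UnitaryGroup.coe_reindexGL, UnitaryGroup.coe_reindexGL,
    Matrix.reindex_apply, Matrix.reindex_apply, Matrix.submatrix_submatrix, Equiv.symm_symm, Equiv.symm_comp_self, Matrix.submatrix_id_id]

/-- **`blk w_Δ = diag(1, −1)`**. [cite: GelbartPiatetskishapiroRallis1987, Part A §1] -/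
theorem blk_weylDelta : blk L e dV hdV dW hdW (weylDelta L e dV hdV dW hdW) = Matrix.fromBlocks 1 0 0 (-1) := by
  rw [weylDelta, blk_iotaGG_eq, coe_negOnePair]
  simp only [OneMemClass.coe_one, Units.val_one, Matrix.reindex_apply, Matrix.submatrix_neg, Pi.neg_apply, Matrix.submatrix_one_equiv]

/-- **`w_Δ² = 1`**. [cite: GelbartPiatetskishapiroRallis1987, Part A §1] -/
theorem weylDelta_mul_weylDelta : weylDelta L e dV hdV dW hdW * weylDelta L e dV hdV dW hdW = 1 := by
  rw [weylDelta, ← map_mul, Prod.mk_mul_mk, mul_one, negOnePair_mul_negOnePair, ← Prod.one_eq_mk, map_one]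

/-- `w_Δ⁻¹ = w_Δ`. [cite: GelbartPiatetskishapiroRallis1987, Part A §1] -/
theorem weylDelta_inv : (weylDelta L e dV hdV dW hdW)⁻¹ = weylDelta L e dV hdV dW hdW :=
  inv_eq_of_mul_eq_one_right (weylDelta_mul_weylDelta L e dV hdV dW hdW)

/-- the triangular frame of `w_Δ`: `E₁ · blk w_Δ · E₂ = (1 0; −2 −1)` — its lower-left block `−2` is invertible, so `w_Δ ∉ P_Δ(𝔸)` as soon as
`n ≠ 0` (the big cell). [cite: GelbartPiatetskishapiroRallis1987, Part A §1] -/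
theorem conjE_blk_weylDelta :
    Matrix.fromBlocks (1 : Matrix (Fin n) (Fin n) (AdeleRing (𝓞 L) L)) 0 (-1) 1 * blk L e dV hdV dW hdW (weylDelta L e dV hdV dW hdW) *
        Matrix.fromBlocks 1 0 1 1 = Matrix.fromBlocks 1 0 (-2) (-1) := by
  rw [blk_weylDelta, conjE_eq, Matrix.toBlocks_fromBlocks₁₁, Matrix.toBlocks_fromBlocks₁₂, Matrix.toBlocks_fromBlocks₂₁,
    Matrix.toBlocks_fromBlocks₂₂, add_zero, zero_add, sub_zero]
  congr 1
  rw [sub_eq_add_neg, ← neg_add, one_add_one_eq_two]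

/-! ## §4 The constant term along `N_Δ` and the Siegel intertwining integral -/

/-- **The constant term along `N_Δ`**: `φ_{P_Δ}(h) = ∫_{N_Δ(L⁺)\N_Δ(𝔸)} φ(u h) dν(u)`, each coset read at a representative (`Quotient.out`; for a
left-`N_Δ(L⁺)`-invariant `φ` — e.g. an automorphic form on `H` — the integrand does not depend on the choice).  The invariant probability
measure `ν` of the compact commutative group `N_Δ(L⁺)\N_Δ(𝔸)` is a PARAMETER (sockets quantify it with its Haar ∕ probability predicates).
Junk: the Bochner integral is `0` when the integrand is not integrable. [cite: MoeglinWaldspurger1995, I.2.6, II.1.7] [cite: Tan1999, §2] -/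
def constTermDelta [MeasurableSpace (UnipDeltaQuot L e dV hdV dW hdW)] (ν : Measure (UnipDeltaQuot L e dV hdV dW hdW))
    (φ : HA L e dV hdV dW hdW → ℂ) (h : HA L e dV hdV dW hdW) : ℂ :=
  ∫ q, φ (((Quotient.out q : unipDelta L e dV hdV dW hdW) : HA L e dV hdV dW hdW) * h) ∂ν

/-- **The Siegel intertwining integral** `M(s)f(h) = ∫_{N_Δ(𝔸)} f(w_Δ u h) dνN(u)` (absolutely convergent for `Re s > n/2` on Siegel sections and
then a section of `I(−s, (χ∘c)⁻¹)` — later organs; here the bare Bochner integral against a PARAMETER measure `νN` on `N_Δ(𝔸)`, junk `0` when not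
integrable). [cite: MoeglinWaldspurger1995, II.1.6] [cite: Tan1999, §2] [cite: GelbartPiatetskishapiroRallis1987, Part A §2] -/
def intertwiningDelta [MeasurableSpace (unipDelta L e dV hdV dW hdW)] (νN : Measure (unipDelta L e dV hdV dW hdW))
    (f : HA L e dV hdV dW hdW → ℂ) (h : HA L e dV hdV dW hdW) : ℂ :=
  ∫ u, f (weylDelta L e dV hdV dW hdW * (u : HA L e dV hdV dW hdW) * h) ∂νN

/-- The constant term of the zero function vanishes. [cite: MoeglinWaldspurger1995, II.1.7] -/
theorem constTermDelta_zero [MeasurableSpace (UnipDeltaQuot L e dV hdV dW hdW)] (ν : Measure (UnipDeltaQuot L e dV hdV dW hdW))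
    (h : HA L e dV hdV dW hdW) : constTermDelta L e dV hdV dW hdW ν (fun _ => 0) h = 0 := by
  simp [constTermDelta]

/-- The intertwining integral of the zero function vanishes. [cite: MoeglinWaldspurger1995, II.1.6] -/
theorem intertwiningDelta_zero [MeasurableSpace (unipDelta L e dV hdV dW hdW)] (νN : Measure (unipDelta L e dV hdV dW hdW))
    (h : HA L e dV hdV dW hdW) : intertwiningDelta L e dV hdV dW hdW νN (fun _ => 0) h = 0 := by
  simp [intertwiningDelta]

/-- **The constant term of a Siegel SECTION is the section times the volume**: `∫_{N_Δ(L⁺)\N_Δ(𝔸)} f(u h) dν = ν(N_Δ(L⁺)\N_Δ(𝔸)) · f(h)`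
(`f` is left-`N_Δ(𝔸)`-invariant, `apply_unipDelta_mul`) — the `w = 1` cell of the constant term of the Eisenstein series.
[cite: MoeglinWaldspurger1995, II.1.7] [cite: Tan1999, §2] -/
theorem constTermDelta_of_isSiegelDeltaSection [MeasurableSpace (UnipDeltaQuot L e dV hdV dW hdW)] (ν : Measure (UnipDeltaQuot L e dV hdV dW hdW))
    {χ : HeckeCharacter L} {s : ℂ} {f : HA L e dV hdV dW hdW → ℂ} (hf : IsSiegelDeltaSection L e dV hdV dW hdW χ s f)
    (h : HA L e dV hdV dW hdW) : constTermDelta L e dV hdV dW hdW ν f h = (ν Set.univ).toReal * f h := by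
  unfold constTermDelta
  have hconst : (fun q : UnipDeltaQuot L e dV hdV dW hdW =>
      f (((Quotient.out q : unipDelta L e dV hdV dW hdW) : HA L e dV hdV dW hdW) * h)) = fun _ => f h := by
    funext q
    exact apply_unipDelta_mul hf (Quotient.out q : unipDelta L e dV hdV dW hdW).2 h
  rw [hconst, integral_const, Complex.real_smul, measureReal_def]

end Literature.NumberTheory.K2Lit.SiegelDoubled
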